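import Summits.QuantumFields.QCD.Theorems.CoerciveSea.Negative.PinWindow
import Summits.QuantumFields.QCD.Theorems.RobustYangMillsHandover.Negative.SchemeAsymptotics

/-!
# Crux `CoerciveSea` (stmt-QuantumFields-13901), negative side — the pin is SELF-SUFFICIENT:
# it alone forces `a_k / Z_m(k) → 0`, `limsup mcrit ≤ 0`, `liminf mcrit ≥ −8`; and at the
# resolution `t / s₀` of clause (i) the valence offset is eventually invisible

Support file of the standing disprover (refuter-cdisprove-stmt-QuantumFields-13901-g2-0, cycle 2),
companion of `PinWindow.lean` (cycle 1). Proved here (sorry-free, standard axioms), for the VERBATIM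
pin clause `PinClause Nf reg M₀ m R` of `PinWindow.lean` and the verbatim crux body `CoerciveSeaAt`:

* `PinClause.tendsto_a_div_Zm` — the pin ALONE (no `HasMassScaling`, every `N_f`, every `M₀ : ℝ`)
  forces the lattice-to-bare mass conversion to degenerate: `a_k / Z_m(k) → 0`. Mechanism: the pin
  window `mcrit k − a_k M / Z_m k ∈ (−8, 0)` (`PinClause.mass_mem_Ioo`) at two depths `M₁ < M₂`
  gives `(a_k/Z_m k)(M₂ − M₁) < 8` eventually, for every gap `M₂ − M₁`.
* `PinClause.mcrit_lt_eventually`, `PinClause.neg_eight_lt_mcrit_eventually` — hence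
  `limsup mcrit ≤ 0` and (for `M₀ > −1`) `liminf mcrit ≥ −8`, again from the pin alone
  (cycle 1 / the sibling seat on stmt-13900 needed `HasMassScaling` and `N_f ≤ 16` for the first).
* `PinClause.tendsto_valenceOffset` — every valence mass merges with the critical line in lattice
  units: `a_k μ / Z_m k → 0` for every `μ`.
* `not_coerciveSeaAt_of_frequently_pos` / `not_coerciveSeaAt_heavyJunkReg_all` — the heavy junk
  corner (where clauses (i),(ii) hold vacuously, `coerciveSeaWithoutPin_holds`) is dead for EVERY
  `N_f`, superseding the `N_f ≤ 16` versions of `PinWindow.lean`.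
* `valenceOffset_mul_side_le`, `tendsto_valenceOffset_mul_windowTop` — RESOLUTION OF CLAUSE (i):
  for a window box (`s_i a_k ≤ ℓ`) the valence offset `a_k m_f / Z_m k` measured in the Dirichlet-gap
  unit `1/s_i` of the box is `≤ m_f ℓ / Z_m k → 0` (`HasMassScaling`, `N_f ≤ 16`: `Z_m → ∞`,
  `RobustYangMillsHandover.Negative.tendsto_Zm_atTop`). Reading for provers: at the threshold
  `t/s₀` of clause (i) the valence mass, the critical line and every pin probe `mcrit − a_k M/Z_m`
  are eventually INDISTINGUISHABLE on every window box — clause (i) is a statement AT the critical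
  line; no argument that uses the bare valence offset as a spectral cushion (`σ_min(D_c(m_f)) ≥
  σ_min(D_c(m_crit)) − a_k m_f/Z_m`) gains anything at the window top.
-/

noncomputable section

namespace Summit.QuantumFields.QCD.Theorems.CoerciveSeaNegative

open MeasureTheory Filter Matrix
open Literature.MathematicalPhysics.QuantumLattice Literature.MathematicalPhysics.QuantumFieldTheory
  Literature.Probability.LatticeModels

/-! ## The pin alone forces `a_k / Z_m(k) → 0` -/

/-- **Pin ⇒ `a_k / Z_m k → 0`.** For the verbatim pin clause (any `N_f`, any real `M₀`, no scaling
hypothesis): comparing the pin windows (`PinClause.mass_mem_Ioo`) at the depths `M₀ + 1` and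
`M₀ + 1 + 8/b` gives `a_k/Z_m k < b` eventually, for every `b > 0`. [folklore] -/
theorem PinClause.tendsto_a_div_Zm {Nf : ℕ} {reg : QCDRegularisation Nf} {M₀ : ℝ} {m : Fin Nf → ℝ}
    {R : ℝ} (h : PinClause Nf reg M₀ m R) :
    Tendsto (fun k => reg.a k / reg.Zm k) atTop (nhds 0) := by
  rw [tendsto_order]
  refine ⟨fun b hb => Eventually.of_forall fun k => hb.trans_le ?_, fun b hb => ?_⟩
  · exact div_nonneg (reg.a_pos k).le (reg.Zm_pos k).le
  · have h1 := h.mass_mem_Ioo (M := M₀ + 1) (by linarith)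
    have h8b : (0 : ℝ) < 8 / b := by positivity
    have h2 := h.mass_mem_Ioo (M := M₀ + 1 + 8 / b) (by linarith)
    filter_upwards [h1, h2] with k hk1 hk2
    have ha := reg.a_pos k
    have hZ := reg.Zm_pos k
    have hlt : reg.a k * (M₀ + 1 + 8 / b) / reg.Zm k - 8 < reg.a k * (M₀ + 1) / reg.Zm k := by
      linarith [hk1.2, hk2.1]
    have hkey : reg.a k / reg.Zm k * (8 / b) < 8 := by
      have : reg.a k * (M₀ + 1 + 8 / b) / reg.Zm k - reg.a k * (M₀ + 1) / reg.Zm k =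
          reg.a k / reg.Zm k * (8 / b) := by
        field_simp
        ring
      linarith
    calc reg.a k / reg.Zm k = reg.a k / reg.Zm k * (8 / b) / (8 / b) := by field_simp
      _ < 8 / (8 / b) := by gcongr
      _ = b := by field_simp

/-- **Pin ⇒ every valence offset vanishes in lattice units**: `a_k μ / Z_m k → 0` for every `μ`
(so every valence mass `mcrit k + a_k m_f / Z_m k` and every pin probe `mcrit k − a_k M / Z_m k`
merges with `mcrit k`). [folklore] -/
theorem PinClause.tendsto_valenceOffset {Nf : ℕ} {reg : QCDRegularisation Nf} {M₀ : ℝ}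
    {m : Fin Nf → ℝ} {R : ℝ} (h : PinClause Nf reg M₀ m R) (μ : ℝ) :
    Tendsto (fun k => reg.a k * μ / reg.Zm k) atTop (nhds 0) := by
  have := h.tendsto_a_div_Zm.mul_const μ
  rw [zero_mul] at this
  refine this.congr fun k => ?_
  ring

/-- **Pin ⇒ `limsup mcrit ≤ 0`** (no scaling hypothesis, every `N_f`): `mcrit k < η` eventually
for every `η > 0`, since `mcrit k < a_k (M₀+1)/Z_m k → 0`. [folklore] -/
theorem PinClause.mcrit_lt_eventually {Nf : ℕ} {reg : QCDRegularisation Nf} {M₀ : ℝ}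
    {m : Fin Nf → ℝ} {R : ℝ} (h : PinClause Nf reg M₀ m R) {η : ℝ} (hη : 0 < η) :
    ∀ᶠ k in atTop, reg.mcrit k < η := by
  have h1 := h.mass_mem_Ioo (M := M₀ + 1) (by linarith)
  have h2 := (tendsto_order.mp (h.tendsto_valenceOffset |M₀ + 1|)).2 η hη
  filter_upwards [h1, h2] with k hk1 hk2
  have ha := reg.a_pos k
  have hZ := reg.Zm_pos k
  have hle : reg.a k * (M₀ + 1) / reg.Zm k ≤ reg.a k * |M₀ + 1| / reg.Zm k := by
    gcongr
    exact le_abs_self _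
  linarith [hk1.2]

/-- **Pin ⇒ `liminf mcrit ≥ −8`** (for `M₀ > −1`; the crux has `M₀ ≥ 0`): `−8 < mcrit k`
eventually, since `−8 < mcrit k − a_k (M₀+1)/Z_m k < mcrit k`. [folklore] -/
theorem PinClause.neg_eight_lt_mcrit_eventually {Nf : ℕ} {reg : QCDRegularisation Nf} {M₀ : ℝ}
    {m : Fin Nf → ℝ} {R : ℝ} (h : PinClause Nf reg M₀ m R) (hM₀ : -1 < M₀) :
    ∀ᶠ k in atTop, -8 < reg.mcrit k := by
  filter_upwards [h.mass_mem_Ioo (M := M₀ + 1) (by linarith)] with k hk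
  have hpos : 0 < reg.a k * (M₀ + 1) / reg.Zm k :=
    div_pos (mul_pos (reg.a_pos k) (by linarith)) (reg.Zm_pos k)
  linarith [hk.1]

/-! ## Consequences for the crux body `CoerciveSeaAt` (every `N_f`) -/

/-- Any witness of the crux body has `a_k/Z_m k → 0`, `limsup mcrit ≤ 0` and `liminf mcrit ≥ −8`
— from the pin alone. [folklore] -/
theorem CoerciveSeaAt.pin_asymptotics {Nf : ℕ} {reg : QCDRegularisation Nf}
    (h : CoerciveSeaAt Nf reg) :
    Tendsto (fun k => reg.a k / reg.Zm k) atTop (nhds 0) ∧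
      (∀ η : ℝ, 0 < η → ∀ᶠ k in atTop, reg.mcrit k < η) ∧ (∀ᶠ k in atTop, -8 < reg.mcrit k) := by
  obtain ⟨M₀, hM₀, hm⟩ := h.pin
  haveI : Nonempty (Fin Nf → ℝ) := ⟨fun _ => M₀ + 1⟩
  obtain ⟨R, -, hpin⟩ := hm (fun _ => M₀ + 1) (fun _ => by linarith)
  exact ⟨hpin.tendsto_a_div_Zm, fun η hη => hpin.mcrit_lt_eventually hη,
    hpin.neg_eight_lt_mcrit_eventually (by linarith)⟩

/-- **The heavy junk corner is dead for EVERY `N_f`** (supersedes `not_coerciveSeaAt_of_frequently_ge`,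
which needed `N_f ≤ 16` and `HasMassScaling`): a regularisation whose critical mass is `≥ c > 0`
infinitely often cannot witness the crux body. [folklore] -/
theorem not_coerciveSeaAt_of_frequently_pos {Nf : ℕ} {reg : QCDRegularisation Nf} {c : ℝ}
    (hc : 0 < c) (hge : ∃ᶠ k : ℕ in atTop, c ≤ reg.mcrit k) : ¬ CoerciveSeaAt Nf reg := by
  intro h
  obtain ⟨-, hlt, -⟩ := h.pin_asymptotics
  exact (hge.and_eventually (hlt c hc)).exists.elim fun k hk => absurd hk.2 (not_lt.mpr hk.1)

/-- … in particular the concrete heavy junk regularisation `heavyJunkReg` (`mcrit ≡ 1`, along which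
clauses (i),(ii) hold vacuously: `coerciveSeaWithoutPinAt_heavyJunkReg`) is no witness, for every
`N_f`. [folklore] -/
theorem not_coerciveSeaAt_heavyJunkReg_all (Nf : ℕ) : ¬ CoerciveSeaAt Nf (heavyJunkReg Nf) :=
  not_coerciveSeaAt_of_frequently_pos one_pos
    (Eventually.frequently (Eventually.of_forall fun _ => le_rfl))

/-- The dichotomy of `PinWindow.lean` for every `N_f`: the pin-less clauses hold along `heavyJunkReg`,
the crux body fails there. [folklore] -/
theorem heavyJunk_dichotomy_all (Nf : ℕ) :
    CoerciveSeaWithoutPinAt Nf (heavyJunkReg Nf) ∧ ¬ CoerciveSeaAt Nf (heavyJunkReg Nf) :=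
  ⟨coerciveSeaWithoutPinAt_heavyJunkReg Nf, not_coerciveSeaAt_heavyJunkReg_all Nf⟩

/-- A witness whose critical mass stays `≤ −8 − δ` infinitely often is excluded as well (restating
`not_coerciveSeaAt_of_frequently_le_neg_eight` through `pin_asymptotics`). [folklore] -/
theorem not_coerciveSeaAt_of_frequently_le {Nf : ℕ} {reg : QCDRegularisation Nf}
    (h8 : ∃ᶠ k : ℕ in atTop, reg.mcrit k ≤ -8) : ¬ CoerciveSeaAt Nf reg :=
  not_coerciveSeaAt_of_frequently_le_neg_eight h8

/-- On the crux itself: every witness regularisation of `CoerciveSea` has the three asymptotics.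
[folklore] -/
theorem coerciveSea_pin_asymptotics (h : Theses.NestedDissectionSea.CoerciveSea) (Nf : ℕ)
    (hNf : Nf = 2 ∨ Nf = 3) :
    ∃ reg : QCDRegularisation Nf, CoerciveSeaAt Nf reg ∧
      Tendsto (fun k => reg.a k / reg.Zm k) atTop (nhds 0) ∧
      (∀ η : ℝ, 0 < η → ∀ᶠ k in atTop, reg.mcrit k < η) ∧ (∀ᶠ k in atTop, -8 < reg.mcrit k) := by
  obtain ⟨reg, hreg⟩ := coerciveSea_iff.mp h Nf hNf
  exact ⟨reg, hreg, hreg.pin_asymptotics⟩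

/-! ## Resolution of clause (i): the valence offset is invisible at the window top -/

/-- For a window box side (`s · a_k ≤ ℓ`) and `μ ≥ 0`, the valence offset `a_k μ / Z_m k` measured in
the Dirichlet-gap unit `1/s` is at most `μ ℓ / Z_m k`. [folklore] -/
theorem valenceOffset_mul_side_le {Nf : ℕ} (reg : QCDRegularisation Nf) {μ ℓ : ℝ} (hμ : 0 ≤ μ)
    (k : ℕ) {s : ℕ} (hs : (s : ℝ) * reg.a k ≤ ℓ) :
    reg.a k * μ / reg.Zm k * s ≤ μ * ℓ / reg.Zm k := by
  have hZ := reg.Zm_pos k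
  rw [div_mul_eq_mul_div, div_le_div_iff_of_pos_right hZ]
  calc reg.a k * μ * s = μ * ((s : ℝ) * reg.a k) := by ring
    _ ≤ μ * ℓ := by gcongr

/-- **`μ ℓ / Z_m k → 0`** under `HasMassScaling` (`N_f ≤ 16`): the bound of
`valenceOffset_mul_side_le` vanishes — eventually in `k` the valence offset is below `η / s` for EVERY
window box and every `η > 0`. [folklore] -/
theorem tendsto_valenceOffset_mul_windowTop {Nf : ℕ} (hNf : Nf ≤ 16) (reg : QCDRegularisation Nf)
    (hms : reg.HasMassScaling) (μ ℓ : ℝ) :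
    Tendsto (fun k => μ * ℓ / reg.Zm k) atTop (nhds 0) := by
  have hZ := RobustYangMillsHandover.Negative.tendsto_Zm_atTop hNf reg hms
  simpa [div_eq_mul_inv] using (tendsto_const_nhds (x := μ * ℓ)).mul hZ.inv_tendsto_atTop

/-- **Resolution of clause (i), assembled.** Along any regularisation with `HasMassScaling`
(`N_f ≤ 16`), for every mass `μ ≥ 0`, window `ℓ` and `η > 0`: eventually in `k`, on every window box
side `s` (`s a_k ≤ ℓ`, `s ≥ 1`) the valence offset is below `η / s` — smaller than any fixed fraction
of the Dirichlet-gap unit in which clause (i) measures separator singularity. [folklore] -/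
theorem valenceOffset_lt_div_side_eventually {Nf : ℕ} (hNf : Nf ≤ 16) (reg : QCDRegularisation Nf)
    (hms : reg.HasMassScaling) {μ : ℝ} (hμ : 0 ≤ μ) (ℓ : ℝ) {η : ℝ} (hη : 0 < η) :
    ∀ᶠ k in atTop, ∀ s : ℕ, 1 ≤ s → (s : ℝ) * reg.a k ≤ ℓ →
      reg.a k * μ / reg.Zm k < η / s := by
  filter_upwards [(tendsto_order.mp (tendsto_valenceOffset_mul_windowTop hNf reg hms μ ℓ)).2 η hη]
    with k hk s hs1 hs
  have hspos : (0 : ℝ) < s := by exact_mod_cast hs1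
  rw [lt_div_iff₀ hspos]
  exact (valenceOffset_mul_side_le reg hμ k hs).trans_lt hk

end Summit.QuantumFields.QCD.Theorems.CoerciveSeaNegative

end
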